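import Summits.MatrixMultiplication.OmegaCensus.STPP211Z2pow6DirectReflect

/-!
# (2,1,1)¹⁰ ⊄ (ℤ/2)⁶ — part S2a: CHUNKING the direct engine's root node (kernel budget per declaration)

Cell `pub-omega` (unit `pub-omega-stpp-1-g37`), topic `Summits/MatrixMultiplication/OmegaCensus`.
HONEST FRAMING (verbatim): lottery ticket; floor = certified bounds/negative ranges. Census STRUCTURE bookkeeping (B5, `T1((ℤ/2)⁶)`, Pb237);
nothing here is a bound on `ω`.

The direct engine `rootD cs d` (`STPP211Z2pow6DirectEngine`, soundness `noNF_of_rootD`) decides one hard class at one root `d` in a single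
kernel evaluation of `10⁵ – 2·10⁶` search calls — more than one declaration may spend. This file splits THE ROOT NODE ONLY: `rootDX cs d M`
is the root node of `rootD cs d` with its `x`-loop (the lower point of the branching label's pair) restricted to the codes in the mask `M`;
its children are the UNCHANGED `goD`. `rootD_of_chunks`: if masks `Ms` cover all 64 codes and every `rootDX cs d M` (`M ∈ Ms`) evaluates to
`true`, then `rootD cs d = true` — so a class is decided by several one-minute declarations and assembled without re-running anything.
Ingredients: `allBits_complete` (the converse of `STPP211Neg.allBits_spec`) and the definitional unfolding `goD_succ_cons`.
Chunk plans (exact call counts per root `x`) come from the seat's C mirror of `goD` (HOME `pub-omega-stpp-1-g37/code/s2/godc.c`, equal to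
`direct_mirror.py` on call counts).

References: H. Cohn, R. Kleinberg, B. Szegedy, C. Umans, FOCS 2005 (arXiv:math/0511460), Def. 5.1.
-/

namespace Summit.MatrixMultiplication.OmegaCensus

namespace T1CosetEng

open STPP211Neg

/-! ## The restricted root node -/

/-- One node of `goD` (fuel `f + 1`, open labels `os`, state `K`) with the `x`-loop restricted to the mask `M`; children = `goD` with fuel `f`. -/
noncomputable def goDX (k : ℕ) (tabs : List ℕ) (f : ℕ) (os : List ℕ) (K M : ℕ) : Bool :=
  force (pickMin k K os) fun u =>
  force (tabs.getD u 0) fun Tu =>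
  force (Nat.land (laneS K u) M) fun L =>
  allBits L (fun x =>
    force (Nat.land (Nat.xor K (salt u x)) (lvS k Tu x)) fun K1 =>
    force (Nat.land (laneS K1 u) (Nat.xor full6 (lowMask (Nat.add x 1)))) fun L2 =>
    allBits L2 (fun y => goD k tabs f (dropL u os) (Nat.land (Nat.xor K1 (salt u y)) (lvS k Tu y))) L2)
  L

/-- **A CHUNK of `rootD cs d`:** its root node with the `x`-loop restricted to the codes in `M`. -/
noncomputable def rootDX (cs : List ℕ) (d M : ℕ) : Bool :=
  force cs.length fun k =>
  force (wmask 6) fun W =>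
  force ((mkTabsS cs W k).getD 0 0) fun T0 =>
  force (Nat.land (Nat.xor (lvS k T0 0) (salt 0 d)) (lvS k T0 d)) fun Kd =>
  goDX k (mkTabsS cs W k) (Nat.sub k 1) (openOf k) Kd M

/-! ## `allBits` is complete -/

/-- **Converse of `allBits_spec`:** if `F ≤ fuel` and `body` holds on every set bit of `F`, the conjunction `allBits fuel body F` holds. -/
theorem allBits_complete (body : ℕ → Bool) : ∀ (fuel F : ℕ), F ≤ fuel → (∀ x, F.testBit x = true → body x = true) →
    allBits fuel body F = true := by
  intro fuel
  induction fuel with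
  | zero => intro F _ _; rfl
  | succ fuel ih =>
      intro F hF h
      by_cases hF0 : F = 0
      · subst hF0; rfl
      have hbeq : Nat.beq F 0 = false := IcosetW.beq_false_of_ne hF0
      show (@Bool.rec (fun _ => Bool) (force (lowBit F) fun L => body (Nat.log2 L) && allBits fuel body (Nat.xor F L)) true
        (Nat.beq F 0)) = true
      rw [hbeq]
      show (force (lowBit F) fun L => body (Nat.log2 L) && allBits fuel body (Nat.xor F L)) = true
      rw [force_eq, Bool.and_eq_true]
      obtain ⟨i, hi, hL, hrem, hbits⟩ := lowBit_spec hF0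
      rw [hL, Nat.log2_two_pow]
      refine ⟨h i hi, ?_⟩
      have hrem' : Nat.xor F (2 ^ i) = Nat.land F (F - 1) := by rw [← hL]; exact hrem
      rw [hrem']
      refine ih (Nat.land F (F - 1)) ?_ fun x hx => h x ?_
      · have : F &&& (F - 1) ≤ F - 1 := Nat.and_le_right
        show F &&& (F - 1) ≤ fuel
        omega
      · rw [hbits x, Bool.and_eq_true] at hx
        exact hx.1

/-! ## Assembling a node from chunks -/

/-- Set bits of a salted lane are codes `< 64`. -/
theorem lt_of_testBit_laneS {K t z : ℕ} (h : (laneS K t).testBit z = true) : z < 64 := by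
  unfold laneS lane at h
  rw [testBit_fld, Bool.and_eq_true, decide_eq_true_eq] at h
  exact h.1

/-- **A node follows from its chunks:** masks covering all 64 codes, every restricted node `true` ⇒ the `goD` node is `true`. -/
theorem goD_of_chunks (k : ℕ) (tabs : List ℕ) (f v : ℕ) (vs : List ℕ) (K : ℕ) (Ms : List ℕ)
    (hcov : ∀ x < 64, ∃ M ∈ Ms, M.testBit x = true) (hch : ∀ M ∈ Ms, goDX k tabs f (v :: vs) K M = true) :
    goD k tabs (f + 1) (v :: vs) K = true := by
  rw [goD_succ_cons, Bool.or_eq_true]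
  right
  simp only [force_eq]
  apply allBits_complete _ _ _ le_rfl
  intro x hx
  obtain ⟨M, hM, hMx⟩ := hcov x (lt_of_testBit_laneS hx)
  have h := hch M hM
  unfold goDX at h
  simp only [force_eq] at h
  refine allBits_spec _ _ _ le_rfl h x ?_
  rw [land_eq, Nat.testBit_land, hx, hMx]; rfl

/-- **`rootD` FROM CHUNKS:** for a non-empty `c`-code list, masks covering all 64 codes and every `rootDX cs d M = true` give
`rootD cs d = true` (to be fed to `noNF_of_rootD`). -/
theorem rootD_of_chunks (cs : List ℕ) (d : ℕ) (Ms : List ℕ) (hk : 2 ≤ cs.length)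
    (hcov : ∀ x < 64, ∃ M ∈ Ms, M.testBit x = true) (hch : ∀ M ∈ Ms, rootDX cs d M = true) : rootD cs d = true := by
  obtain ⟨k', hk'⟩ : ∃ k', cs.length = k' + 2 := ⟨cs.length - 2, by omega⟩
  unfold rootD
  rw [force_eq, force_eq, force_eq, force_eq, hk']
  have hopen : openOf (k' + 2) = 1 :: (List.range k').map fun j => 0 + 1 + (j + 1) := by
    unfold openOf restOf
    rw [show k' + 2 - (0 + 1) = k' + 1 by omega, List.range_succ_eq_map, List.map_cons, List.map_map]; rfl
  rw [hopen]
  apply goD_of_chunks _ _ _ _ _ _ Ms hcov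
  intro M hM
  have h := hch M hM
  unfold rootDX at h
  rw [force_eq, force_eq, force_eq, force_eq, hk', hopen] at h
  exact h

/-- Covering by the four range masks of 16 codes each (the usual chunk masks are unions/splits of these; any cover works). -/
theorem cover_of_all64 (Ms : List ℕ) (h : (List.range 64).all (fun x => Ms.any fun M => M.testBit x) = true) :
    ∀ x < 64, ∃ M ∈ Ms, M.testBit x = true := by
  intro x hx
  have := List.all_eq_true.1 h x (List.mem_range.2 hx)
  obtain ⟨M, hM, hMx⟩ := List.any_eq_true.1 this
  exact ⟨M, hM, hMx⟩

end T1CosetEng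

end Summit.MatrixMultiplication.OmegaCensus
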